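import Summits.CriticalPhenomena.CardyFormulaZ2.Theorems.CardyBondTriangularBondTriangularCardyWeakAssembly
import Summits.CriticalPhenomena.CardyFormulaZ2.Theorems.CardyBondTriangularBondTriangularCardyWeakLimits
import Summits.CriticalPhenomena.CardyFormulaZ2.Theorems.CardyBondTriangularBondTriangularCardyWeakContour
import HarnessLib

/-!
# Route CardyBondTriangular · crux `BondTriangularCardy` (stmt-CriticalPhenomena-4664), line `birth`:
# stub `stub_weakBoundaryUpgrade` — weak separating data are separating data (`ω ≠ 1`)

Bollobás–Riordan's separating data (`IsSeparatingData`, `SmirnovSeparatingData.lean`) ask, on each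
open arc `Aᵢ`, for points `z_δ → z` with `fⁱ_δ(z_δ) → 0` AND `f^{i+1}_δ(z_δ) + f^{i+2}_δ(z_δ) → 1`.
The line's WEAK separating data (`Sig.IsWeakSepData`) have only the first clause, plus the corner
normalisation `f²_δ(z_δ) → 1` for some `z_δ → R.pt 1`. This file proves the registered analysis
stub of the line: for `ω ≠ 1` weak separating data are separating data. The argument is
Smirnov's own for `Σᵢ hⁱ ≡ 1` (Bollobás–Riordan 2006, Ch. 7, proof of Claim 24 p. 201: "by Morera
`Σ gⁱ` is analytic … `≡ 1`"), run by contradiction through a subsequence: if along the weak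
clause's points `z_δ → z ∈ Aᵢ` the sums `f^{i+1}_δ(z_δ) + f^{i+2}_δ(z_δ)` stay `≥ ε` away from
`1` along `δ_n → 0⁺`, extract (Arzelà–Ascoli, `exists_subseq_tendstoUniformlyOn_dataFamily`) a
uniform limit `G` of the McShane interpolants on `closure Ω`; it satisfies the contour relation
(36) on lattice triangles (`limit_contour_weak`), so `Σ Gⁱ ≡ c` on `closure Ω`
(`exists_sum_limit_eq_const`: `(1 - ω) ∮ Σ Gⁱ = 0`, lattice Morera, open mapping); the weak
clause gives `Gʲ = 0` on the closed arc `A_j` (`tendsto_data_of_tendstoUniformlyOn` and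
continuity), so at `R.pt 1 ∈ A₀ ∩ A₁` the corner clause gives `c = G²(R.pt 1) = 1`; hence
`G^{i+1}(z) + G^{i+2}(z) = 1 - Gⁱ(z) = 1`, while the discrete sums tend to
`G^{i+1}(z) + G^{i+2}(z)` along the subsequence — contradiction. No percolation is involved.

The registered texts `Sig.IsWeakSepData` and `Sig.stub_weakBoundaryUpgrade` are the definitions
of the lead's file `…BondTriangularCardyWeakAssembly` (imported), in this namespace.

References: B. Bollobás, O. Riordan, *Percolation*, CUP 2006, Ch. 7, (9) p. 180, Lemma 13 p. 181,
§7.2.6 pp. 196–201, Claim 24 p. 201 [BollobasRiordan2006]; S. Smirnov, C. R. Acad. Sci. Paris 333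
(2001) 239–244 [Smirnov2001].
-/

noncomputable section

namespace Summit.CriticalPhenomena.CardyFormulaZ2.Theorems.BondTriangularCardyLine

open Set Filter Topology Metric
open Literature.Probability.Percolation Literature.Probability.RandomPlanarGeometry
open Literature.Probability.RandomPlanarGeometry.MarkedDomain
open Literature.Probability.LatticeModels

/-! ### The proof of the stub -/

/-- **Stub `stub_weakBoundaryUpgrade` of line `birth`: weak separating data are separating data
when `ω ≠ 1`** (Bollobás–Riordan 2006, Ch. 7, proof of Claim 24 p. 201 / Smirnov 2001: the
sum-to-one boundary clause follows from the contour relation, the vanishing clause and one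
corner normalisation, by "`Σ gⁱ` is analytic, real, hence `≡ 1`" applied to every subsequential
limit of the interpolants; see the module docstring). [cite: BollobasRiordan2006, Ch. 7 proof of Claim 24 p. 201] -/
theorem stub_weakBoundaryUpgrade : Sig.stub_weakBoundaryUpgrade := by
  intro R ω S f hω hW
  obtain ⟨hIcc, hdense, hint, hequi, hcau, hweak, hcorner⟩ := hW
  refine ⟨hIcc, hdense, hint, hequi, hcau, fun i z hz => ?_⟩
  obtain ⟨zs, hzs, hzt, hf0⟩ := hweak i z hz
  refine ⟨zs, hzs, hzt, hf0, ?_⟩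
  obtain ⟨ε, hε, hdense'⟩ := hdense
  -- suppose not: a sequence `δ_n → 0⁺` along which the sums stay `≥ η` away from `1`
  by_contra hnot
  obtain ⟨U, hU, hfreq⟩ := not_tendsto_iff_exists_frequently_notMem.1 hnot
  obtain ⟨η, hη, hball⟩ := Metric.mem_nhds_iff.1 hU
  have hfr : ∃ᶠ δ in 𝓝[>] (0 : ℝ), f δ (i + 1) (zs δ) + f δ (i + 2) (zs δ) ∉ ball (1 : ℝ) η ∧
      (0 < δ ∧ (zs δ ∈ S δ ∧ zs δ ∈ R.carrier)) :=
    (hfreq.mono fun δ h h' => h (hball h')).and_eventually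
      ((eventually_mem_nhdsWithin (a := (0 : ℝ)) (s := Ioi 0)).and hzs)
  obtain ⟨u, hu, hu'⟩ := exists_seq_forall_of_frequently hfr
  have hupos : ∀ n, 0 < u n := fun n => (hu' n).2.1
  -- Arzelà–Ascoli: a subsequence of the interpolants converging uniformly on `closure Ω`
  obtain ⟨φ, hφ, G, hGc, hGunif⟩ :=
    exists_subseq_tendstoUniformlyOn_dataFamily R S f ε hIcc hequi hε hdense' u hupos
  set v : ℕ → ℝ := u ∘ φ with hv_def
  have hv : Tendsto v atTop (𝓝[>] 0) := hu.comp hφ.tendsto_atTop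
  have hvpos : ∀ n, 0 < v n := fun n => hupos (φ n)
  have hv0 : Tendsto v atTop (𝓝 0) := hv.mono_right nhdsWithin_le_nhds
  -- (36) for the limit, and `Σ Gⁱ ≡ c` on `closure Ω`
  have h36 : ∀ (j : Fin 3) (p : ℂ) (r : ℝ), convexHull ℝ {p, p + r, p + r * triZeta} ⊆ R.carrier →
      triangleIntegral (fun w => (G (j + 1) w : ℂ) - ω * G j w) p (p + r) (p + r * triZeta) = 0 :=
    fun j p r hT => limit_contour_weak hIcc hequi hint hcau hε hvpos hv0 hGc hGunif j p r hT
  obtain ⟨c, hc⟩ := exists_sum_limit_eq_const R ω G hω hGc h36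
  -- the data along convergent points of `S_δ ∩ Ω` tend to the limit
  have hdata : ∀ (j : Fin 3) {ws : ℝ → ℂ} {w : ℂ},
      (∀ᶠ δ in 𝓝[>] (0 : ℝ), ws δ ∈ S δ ∧ ws δ ∈ R.carrier) → Tendsto ws (𝓝[>] 0) (𝓝 w) →
        Tendsto (fun n => f (v n) j (ws (v n))) atTop (𝓝 (G j w)) :=
    fun j ws w hws hwt => tendsto_data_of_tendstoUniformlyOn hIcc hequi hε hv
      (hGc j).continuousOn j (hGunif j) (hv.eventually hws) (hwt.comp hv)
  -- `Gʲ = 0` on the open arc `A_j`, hence on the closed arc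
  have hopen : ∀ (j : Fin 3), ∀ w ∈ (forgetLast R).boundary ''
      Ioo ((forgetLast R).mark j) ((forgetLast R).nextMark j), G j w = 0 := by
    intro j w hw
    obtain ⟨ws, hws, hwt, hw0⟩ := hweak j w hw
    exact tendsto_nhds_unique (hdata j hws hwt) (hw0.comp hv)
  have hclosed : ∀ (j : Fin 3), ∀ w ∈ (forgetLast R).arc j, G j w = 0 := by
    intro j w hw
    have hZ : IsClosed {w : ℂ | G j w = 0} := isClosed_eq (hGc j) continuous_const
    exact closure_minimal (fun w hw => hopen j w hw) hZ
      ((forgetLast R).arc_subset_closure_image_Ioo j hw)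
  -- at the corner `R.pt 1 ∈ A₀ ∩ A₁`: `G⁰ = G¹ = 0`, `G² = 1`, so `c = 1`
  have h0 : G 0 (R.pt 1) = 0 := hclosed 0 _ ((forgetLast R).pt_succ_mem_arc 0)
  have h1 : G 1 (R.pt 1) = 0 := hclosed 1 _ ((forgetLast R).pt_mem_arc_self 1)
  have h2 : G 2 (R.pt 1) = 1 := by
    obtain ⟨cs, hcs, hct, hc1⟩ := hcorner
    exact tendsto_nhds_unique (hdata 2 hcs hct) (hc1.comp hv)
  have hc1 : c = 1 := by
    have h := hc _ (frontier_subset_closure (R.pt_mem_frontier 1))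
    rw [h0, h1, h2] at h
    linarith
  -- at `z ∈ Aᵢ`: `G^{i+1}(z) + G^{i+2}(z) = 1 - Gⁱ(z) = 1`
  have hzcl : z ∈ closure R.carrier := by
    obtain ⟨t, -, rfl⟩ := hz
    exact frontier_subset_closure (R.boundary_mem_frontier t)
  have hGz : G i z = 0 := hopen i z hz
  have hsum : G (i + 1) z + G (i + 2) z = 1 := by
    have h := hc z hzcl
    rw [hc1] at h
    fin_cases i
    · simp only [Fin.zero_eta, Fin.isValue] at hGz ⊢
      simp only [zero_add, Fin.isValue, show (0 : Fin 3) + 2 = 2 from rfl]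
      linarith
    · simp only [Fin.mk_one, Fin.isValue] at hGz ⊢
      simp only [Fin.isValue, show (1 : Fin 3) + 1 = 2 from rfl, show (1 : Fin 3) + 2 = 0 from rfl]
      linarith
    · simp only [Fin.reduceFinMk, Fin.isValue] at hGz ⊢
      simp only [Fin.isValue, show (2 : Fin 3) + 1 = 0 from rfl, show (2 : Fin 3) + 2 = 1 from rfl]
      linarith
  -- the discrete sums tend to `1` along the subsequence: contradiction
  have hlim : Tendsto (fun n => f (v n) (i + 1) (zs (v n)) + f (v n) (i + 2) (zs (v n))) atTop
      (𝓝 1) := by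
    rw [← hsum]
    exact (hdata (i + 1) hzs hzt).add (hdata (i + 2) hzs hzt)
  obtain ⟨n, hn⟩ := (hlim.eventually (ball_mem_nhds (1 : ℝ) hη)).exists
  exact (hu' (φ n)).1 hn

end Summit.CriticalPhenomena.CardyFormulaZ2.Theorems.BondTriangularCardyLine

end
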